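import Summits.CriticalPhenomena.PercolationContinuityZ3.Theorems.PercNearOneGluingNoHeavyLowerTailOneCutFiveZeroOne
import HarnessLib

/-!
# `NoHeavyLowerTail` (stmt-CriticalPhenomena-4575) — the exact CERTIFICATE TARGET for the glued half of the `|A| = 5` one-cut bound

Support file (prover seat `prim-a5-assembly-1`, `--supports stmt-CriticalPhenomena-4575`; memo `run/shared/lean/prim/prim-a5/ASSEMBLY.md` §12).
One `Prop` definition, no sorries, standard axioms.

`OneCutFive.TwoFingerAtObserver` is the `a = o` instance of `OneCutFive.TwoFingerHub` (the five-point row X′(5) at the observer): for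
`A.card = 5`, `o ∈ A`, `Σ_{x∈A} μ(o ↔ x) > 4` and `t` bounding the four cuts `μ(o ↮ b)`, `b ∈ A ∖ o`:  `μ{|T_o| ≤ 2} ≤ t`.
This is EXACTLY the statement whose superset-cone LP over the proved rows (two-set BHK with vertex sets, FINE-PA, Gladkov DT / dtRefined,
GRP3PTLB) has no pseudo-law (ttrl cp-wf3b XP01: constrained minimum +0.0105, converged from two starts, 2026-08-20T02:06Z); the exact
certificate is being extracted and, once replayed in the kernel, discharges this `Prop`.  Bookkeeping proved here:
* `twoFingerAtObserver_of_twoFingerHub`, `twoFingerAtObserver_of_zeroOneThree` (the two census-clean routes to it);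
* `oneCut5_glued_of_twoFingerAtObserver` — it closes the `o ∈ A` half of `OneCutFive.OneCut5`;
* `oneCut5_of_twoFingerAtObserver_of_twoFingerBound_of_cil25` is NOT needed: `oneCut5_of_twoFingerBound_of_cil25` already covers both halves;
  the point of this file is the minimal glued target.
[cite: KozmaNitzan2024, Lemma 2 (p. 6) (level 1 of the family; the level-2 statement is ours)]
-/

noncomputable section

namespace Summit.CriticalPhenomena.PercolationContinuityZ3.Theorems

open MeasureTheory Set Literature.Probability.LatticeModels Literature.Probability.Percolation
open scoped Classical BigOperators

namespace OneCutFive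

variable {n : ℕ}

/-- **X′(5) at the observer** (the exact certificate target for the glued half of oneCut(5)): for `A.card = 5`, `o ∈ A`,
`Σ_{x∈A} μ(o ↔ x) > 4` and `t` bounding `μ(o ↮ b)` for all `b ∈ A ∖ o`: `μ{|T_o| ≤ 2} ≤ t`.  OPEN (conjectured in this programme;
census n ≤ 7 exhaustive, no pseudo-law over the proved cone). [cite: KozmaNitzan2024, Lemma 2 (p. 6) (level 1; the level-2 statement is ours)] [status: open] -/
@[conjecture] def TwoFingerAtObserver : Prop :=
  ∀ (n : ℕ) (w : Sym2 (Fin n) → unitInterval) (A : Finset (Fin n)) (o : Fin n) (t : ℝ), A.card = 5 → o ∈ A →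
    4 < ∑ x ∈ A, (prodBernoulli w).real (openConn o x) →
    (∀ b ∈ A, b ≠ o → (prodBernoulli w).real (openConn o b)ᶜ ≤ t) →
    (prodBernoulli w).real {ω : BondConfig (Fin n) | (A.filter fun x => ω ∈ openConn o x).card ≤ 2} ≤ t

/-- The hub form of X′(5) gives the observer instance (take `a = o`; the cut hypothesis is only used for `b ≠ o`). [this work] -/
theorem twoFingerAtObserver_of_twoFingerHub (h : TwoFingerHub) : TwoFingerAtObserver := by
  intro n w A o t hA ho hEN hcut
  have ht : 0 ≤ t := by
    obtain ⟨b, hb, hbo⟩ : ∃ b ∈ A, b ≠ o := by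
      by_contra hne
      push Not at hne
      have hsub : A ⊆ {o} := fun x hx => Finset.mem_singleton.2 (hne x hx)
      have := Finset.card_le_card hsub
      rw [hA, Finset.card_singleton] at this
      omega
    exact le_trans measureReal_nonneg (hcut b hb hbo)
  exact h n w A o hA hEN o ho t ht fun b hb hbo => hcut b hb hbo

/-- `Z(3,2)` gives the observer instance (`twoFinger_at_observer_of_zeroOneThree`). [this work] -/
theorem twoFingerAtObserver_of_zeroOneThree (hZ : ZeroOneThree) : TwoFingerAtObserver :=
  fun _ w A o t hA ho hEN hcut => twoFinger_at_observer_of_zeroOneThree hZ w A o t hA ho hEN hcut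

/-- **The glued half of oneCut(5) from the certificate target**: if `o ∈ A`, `A.card = 5`, `0 ≤ t` and all relay–relay cuts are `≤ t`,
the minority event `{1 ≤ N < E N/2}` has mass `≤ t` (`E N ≤ 4`: lonely-relay lemma; `E N > 4`: the event lies in `{|T_o| ≤ 2}`). [this work] -/
theorem oneCut5_glued_of_twoFingerAtObserver (hX : TwoFingerAtObserver) (w : Sym2 (Fin n) → unitInterval) (A : Finset (Fin n))
    (o : Fin n) (t : ℝ) (hA : A.card = 5) (ho : o ∈ A) (ht : 0 ≤ t)
    (hcut : ∀ a ∈ A, ∀ a' ∈ A, a ≠ a' → (prodBernoulli w).real (openConn a a')ᶜ ≤ t) :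
    (prodBernoulli w).real {ω : BondConfig (Fin n) |
        1 ≤ (A.filter fun a => ω ∈ openConn o a).card ∧
        ((A.filter fun a => ω ∈ openConn o a).card : ℝ) <
          (∑ a ∈ A, (prodBernoulli w).real (openConn o a)) / 2} ≤ t := by
  by_cases hEN : (∑ x ∈ A, (prodBernoulli w).real (openConn o x)) ≤ 4
  · exact oneCut_of_sum_le_four n w A o t hEN ht hcut
  · have hEN' : 4 < ∑ x ∈ A, (prodBernoulli w).real (openConn o x) := lt_of_not_ge hEN
    have hsub : {ω : BondConfig (Fin n) | 1 ≤ (A.filter fun a => ω ∈ openConn o a).card ∧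
          ((A.filter fun a => ω ∈ openConn o a).card : ℝ) < (∑ a ∈ A, (prodBernoulli w).real (openConn o a)) / 2} ⊆
        {ω : BondConfig (Fin n) | (A.filter fun x => ω ∈ openConn o x).card ≤ 2} :=
      fun ω hω => (minority_subset_le_two w A o hA hω).2
    exact (measureReal_mono hsub).trans (hX n w A o t hA ho hEN' fun b hb hbo => hcut o ho b hb hbo.symm)

end OneCutFive

end Summit.CriticalPhenomena.PercolationContinuityZ3.Theorems
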